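import Summits.QuantumFields.BalabanUV.T4Continuum.Spine.NE2.ComposedRemainderCoherentTowerNonTrivial
import Summits.QuantumFields.BalabanUV.T4Continuum.Spine.NE2.ConstantTransporterLaplacian

/-!
# NE2 / ComposedRemainderCoherentTowerReduced — THE END OF RECORD AT THE gen-8 WITNESS TOWERS WITH ITS VANISHING SLOTS REMOVED FROM THE DISPLAYED OPERATOR
# (cell `pub-balaban-gaps`, seat ne2, generation 9; row NE2 of `HOME/BALABAN-GAPS.md`)

HONEST FRAMING.  Row NE2 (node U1a of the T⁴ uniqueness spine) is NOT PRINTED and NOT PROVED; class word WORK-bound; nothing of Bałaban's is asserted beyond print;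
ONE finite torus; NOT ℝ⁴, NOT infinite volume, NOT a mass gap, NOT Clay.  Bookkeeping over generation 9's three files; no word changes.

WHAT IT SAYS.  `ComposedRemainderCoherentTowerNonTrivial.exists_nonflat_coherent_witness_nontrivial` displays the END's operator at the witness towers `cTow f X` with all
four tier-B slots: the covariant-Laplacian perturbation at `Ad u_top`, the composed averaging `avgPertFull a (TBal(Ad u)) (E″)` with the (124)-remainders `E″ = Erem`, and
`Δ′(u_top)`.  Two of these slots are ZERO at the witnesses (`Erem_cTow_eq_zero`, `deltaPrime_cTow_eq_zero`) and one is a NON-ZERO operator for non-central `X`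
(`ConstantTransporterLaplacian.covPertC_cTow_ne_zero`).  **`exists_nonflat_coherent_witness_reduced`** restates the END with the operator AS IT REALLY IS there —
`[free block Laplacian ⊗ 1] + tierBPert (Ad u_top) (avgPertFull a (TBal(Ad u)) 0) 0`, i.e. `covPertC(Ad u_top) + [composed MAIN-TERM averaging at the tables TBal(Ad u)]` on
top of the free operator — together with, at every level `k`: the tier-B transporters are `≠ 1` at every bond, `covPertC(Ad u_top) k ≠ 0` as an operator, `Erem = 0`,
`Δ′ = 0`.  So the reader of row NE2 sees in ONE kernel statement which parts of the END's hypothesis∕conclusion the non-flat witnesses exercise (the transporter data, the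
covariant-Laplacian summand, the composed main-term tables) and which they do not (the linearisation remainders of [B7] (124) and the curvature term `Δ′` of [B9] (3.10)).
NOT CLAIMED: that the composed-averaging summand, or the full operator, differs from its flat value as an operator; anything about Bałaban's minimiser.
All [folklore]; 0 sorry; axioms ⊆ {propext, Classical.choice, Quot.sound}.
-/

noncomputable section

open scoped BigOperators ComplexConjugate Matrix Matrix.Norms.L2Operator Kronecker

namespace Summit.QuantumFields.BalabanUV.T4Continuum.NE2.ComposedRemainderCoherentTowerReduced

open Literature.MathematicalPhysics.QuantumFieldTheory.Balaban1983to89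
open Literature.MathematicalPhysics.QuantumFieldTheory.Balaban1983to89.B9AdOrthogonal (herm0)
open Literature.MathematicalPhysics.QuantumFieldTheory.Balaban1983to89.B5Prop11Plancherel (Tor fine)
open Literature.MathematicalPhysics.QuantumFieldTheory.Balaban1983to89.B5G183RateUnitTower (lev)
open Summit.QuantumFields.BalabanUV.Beta.AdjointCarrierWiringEnd (CompFamily)
open Summit.QuantumFields.BalabanUV.T4Continuum
open Summit.QuantumFields.BalabanUV.T4Continuum.BalabanAveragedTowerUnit (idx Qlev)
open Summit.QuantumFields.BalabanUV.T4Continuum.KingPairingPlantedLaw (calDalev)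
open Summit.QuantumFields.BalabanUV.T4Continuum.CovariantAveragingTower (TowerLimitRate)
open Summit.QuantumFields.BalabanUV.T4Continuum.RegularBackgroundTower (connTower)
open Summit.QuantumFields.BalabanUV.T4Continuum.ColourCovariantLaplacian (covPertC)
open Summit.QuantumFields.BalabanUV.T4Continuum.NE2BalabanLayer (tierBPert)
open Summit.QuantumFields.BalabanUV.T4Continuum.NE2.CovariantTableBalaban (TBal)
open Summit.QuantumFields.BalabanUV.T4Continuum.NE2.ComposedAveragingRemainder (avgPertFull)
open Summit.QuantumFields.BalabanUV.T4Continuum.NE2.ComposedRemainderTower (Erem)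
open Summit.QuantumFields.BalabanUV.T4Continuum.NE2.OneStepRemainderLoopCoeff (remCoeffOf)
open Summit.QuantumFields.BalabanUV.T4Continuum.NE2.ComposedRemainderGaugeTower (fundT adT)
open Summit.QuantumFields.BalabanUV.T4Continuum.NE2.ComposedRemainderGaugeTowerRegular (topAdT)
open Summit.QuantumFields.BalabanUV.T4Continuum.NE2.TorusBlockAveragePlaquette (bavgTor)
open Summit.QuantumFields.BalabanUV.T4Continuum.NE2.ComposedRemainderCoherentTower (liftU)
open Summit.QuantumFields.BalabanUV.T4Continuum.NE2.DeltaPrimeOperator (deltaPrime)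
open Summit.QuantumFields.BalabanUV.T4Continuum.NE2.ComposedRemainderCoherentTowerDeltaPrime (topU)
open Summit.QuantumFields.BalabanUV.T4Continuum.NE2.ConstantConnectionTower (cTow cTow_mem cph sph)
open Summit.QuantumFields.BalabanUV.T4Continuum.NE2.AdjointRepresentationKernel (cph_sph_top_pos_le_one)
open Summit.QuantumFields.BalabanUV.T4Continuum.NE2.ComposedRemainderCoherentTowerNonTrivial (exists_nonflat_coherent_witness_nontrivial Erem_cTow_eq_zero
  deltaPrime_cTow_eq_zero norm_lt_log_two_of_mul_exp_lt)
open Summit.QuantumFields.BalabanUV.T4Continuum.NE2.ConstantTransporterLaplacian (covPertC_cTow_ne_zero)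

variable {d : ℕ} (L : ℕ) [NeZero L] (M : Fin d → ℕ) [hM : ∀ μ, NeZero (M μ)]
  {n : Type} [Fintype n] [DecidableEq n] {ι : Type} [Fintype ι] [DecidableEq ι] {c : ℝ} {P : Submodule ℝ (Matrix n n ℂ)} {e : ι → Matrix n n ℂ}
  (hF : CompFamily c P e) (a : ℝ) (ha : 0 < a) [Nonempty n] [Nonempty ι]

/-- **THE END OF RECORD AT THE WITNESS TOWERS, REDUCED**: on a frame with `herm0 n ≤ P` and `≥ 2` colour indices there is `t₀ > 0` such that a skew-hermitian NON-CENTRAL `X`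
with `‖X‖e^{‖X‖} < t₀` exists, and for every such `X` and `f ∈ {cph L, sph L}` the tower `u = cTow f X` is coherent and, AT EVERY LEVEL `k`: its tier-B transporters
`Ad(u_k^{(k)})` are `≠ 1` at every bond, the covariant-Laplacian perturbation `covPertC(Ad u_top) k` is a NON-ZERO OPERATOR, the (124)-remainders `Erem … k` and the
curvature term `Δ′(u_top)` are ZERO — and the resolvent tower of the operator AS IT REALLY IS THERE, `[free ⊗ 1] + tierBPert (Ad u_top) (avgPertFull a (TBal(Ad u)) 0) 0`,
satisfies `TowerLimitRate` at rate `ρ ∈ [3∕(2L), 1)`.  TOY data; NE2 NOT proved; full-operator non-triviality not claimed.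
[cite: Balaban1985BackgroundPropagators, (3.3) p.390, (3.10) p.392, (3.26) p.395; Balaban1985Averaging, (42) p.23, (124) p.36 (shapes)] [folklore] -/
theorem exists_nonflat_coherent_witness_reduced [Nontrivial n] (hP : herm0 n ≤ P) (hL : 2 ≤ L) (hd : 1 ≤ d) {ρ : ℝ} (hρ : 3 / (2 * (L : ℝ)) ≤ ρ) (hρ1 : ρ < 1) :
    ∃ t₀ : ℝ, 0 < t₀ ∧
      (∃ X : Matrix n n ℂ, star X = -X ∧ X ∉ Set.range (Matrix.scalar n) ∧ ‖X‖ * Real.exp ‖X‖ < t₀) ∧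
      ∀ (X : Matrix n n ℂ) (hX : star X = -X), ‖X‖ * Real.exp ‖X‖ < t₀ → X ∉ Set.range (Matrix.scalar n) → ∀ f : ℕ → ℕ → ℝ, (f = cph L ∨ f = sph L) →
        (∀ k i, i < k → cTow L M f X k i = bavgTor (lev L i) L M (cTow L M f X k (i + 1))) ∧
        (∀ (k : ℕ) (ν : Fin d) (b : idx L M k), topAdT L M hF (liftU L M (cTow L M f X) (cTow_mem L M f hX)) k ν b ≠ 1) ∧
        (∀ k : ℕ, covPertC L M (topAdT L M hF (liftU L M (cTow L M f X) (cTow_mem L M f hX))) k ≠ 0) ∧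
        (∀ k j : ℕ, Erem L M (adT L M hF (liftU L M (cTow L M f X) (cTow_mem L M f hX) k))
            (remCoeffOf L M (fundT L M (liftU L M (cTow L M f X) (cTow_mem L M f hX) k)) c e (adT L M hF (liftU L M (cTow L M f X) (cTow_mem L M f hX) k))) j = 0) ∧
        (∀ k : ℕ, deltaPrime (fine (lev L k) M) (lev L k) c e (fun ν x => (topU L M (cTow L M f X) (cTow_mem L M f hX) k ν x : Matrix n n ℂ)) = 0) ∧
        ∃ Cp : ℝ, TowerLimitRate (fun k => Qlev L M k ⊗ₖ (1 : Matrix ι ι ℂ)) ((L : ℝ) ^ d)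
          (fun k => (calDalev L M a ha k ⊗ₖ (1 : Matrix ι ι ℂ)
            + tierBPert L M (topAdT L M hF (liftU L M (cTow L M f X) (cTow_mem L M f hX)))
                (avgPertFull L M a (fun k => TBal L M (adT L M hF (liftU L M (cTow L M f X) (cTow_mem L M f hX) k)) k) (fun _ => 0))
                (fun _ => 0) k)⁻¹) Cp ρ := by
  haveI : NeZero d := ⟨by omega⟩
  obtain ⟨t₀, ht₀, -, hall⟩ := exists_nonflat_coherent_witness_nontrivial L M hF a ha hP hL hd hρ hρ1
  refine ⟨min t₀ (1 / 2), lt_min ht₀ (by norm_num), ?_, fun X hX hXt hXc f hf => ?_⟩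
  · -- a small non-central X below min t₀ ½ exists (AdjointRepresentationKernel.exists_noncentral_small)
    obtain ⟨X, hX, hXc, -, hXt⟩ := AdjointRepresentationKernel.exists_noncentral_small (n := n) (lt_min ht₀ (by norm_num : (0 : ℝ) < 1 / 2))
    exact ⟨X, hX, hXc, hXt⟩
  have hXs : ‖X‖ < Real.log 2 := norm_lt_log_two_of_mul_exp_lt (lt_of_lt_of_le hXt (min_le_right _ _)) le_rfl
  obtain ⟨hcoh, hnt, Cp, hT⟩ := hall X hX (lt_of_lt_of_le hXt (min_le_left _ _)) hXc f hf
  have hk := cph_sph_top_pos_le_one L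
  have hf01 : ∀ k, 0 < f k k ∧ f k k ≤ 1 := fun k => by
    rcases hf with rfl | rfl
    · exact (hk k).1
    · exact (hk k).2
  have hE : (fun k => Erem L M (adT L M hF (liftU L M (cTow L M f X) (cTow_mem L M f hX) k))
      (remCoeffOf L M (fundT L M (liftU L M (cTow L M f X) (cTow_mem L M f hX) k)) c e (adT L M hF (liftU L M (cTow L M f X) (cTow_mem L M f hX) k))) k)
      = fun _ => (0 : Matrix ((Tor M × Fin d) × ι) _ ℂ) := by
    funext k; exact Erem_cTow_eq_zero L M c e f hX _ _ k k
  have hD : (fun k => deltaPrime (fine (lev L k) M) (lev L k) c e (fun ν x => (topU L M (cTow L M f X) (cTow_mem L M f hX) k ν x : Matrix n n ℂ)))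
      = fun k => (0 : Matrix (idx L M k × ι) (idx L M k × ι) ℂ) := by
    funext k; exact deltaPrime_cTow_eq_zero L M c e f hX _ k
  refine ⟨hcoh, fun k ν b => (hnt k ν b).1, fun k => covPertC_cTow_ne_zero L M hF hP hX hXs hXc (hf01 k).1 (hf01 k).2,
    fun k j => Erem_cTow_eq_zero L M c e f hX _ _ k j, fun k => deltaPrime_cTow_eq_zero L M c e f hX _ k, Cp, ?_⟩
  rw [hE, hD] at hT
  exact hT

end Summit.QuantumFields.BalabanUV.T4Continuum.NE2.ComposedRemainderCoherentTowerReduced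

end
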